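import Literature.NumberTheory.Sieve.PairShiuClasses
import Literature.NumberTheory.Sieve.PairShiuClassIV
import Literature.NumberTheory.Sieve.DivisorBound
import HarnessLib

/-!
# A Brun–Titchmarsh theorem for a pair of linear forms (bivariate Shiu / Nair–Henriot bound)

Topic `Literature/NumberTheory/Sieve`. Everything here is PROVED; no definition is introduced.
For non-negative `f, g`, multiplicative on coprime arguments, with `f(1) = g(1) = 1`,
`f(p^l), g(p^l) ≤ B^l` and `f(n), g(n) ≤ A₂(δ) n^δ` (every `δ > 0`), and for `1 ≤ m ≤ X^K`,
`1 ≤ h ≤ X^K`, `(m, h) = 1`, `X ≥ X₀(K, B, A₂)`: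

`∑_{n ≤ X} f(n) g(mn + h) ≤ C ψ(h) ψ(m) ∏_{p ∣ h} (1 + 4 f(p) g(p)/p) · X/log² X ·
exp(∑_{p ≤ X} f(p)/p + ∑_{p ≤ X} g(p)/p)`, `ψ(k) = ∏_{p ∣ k, p ≠ 2} (p−1)/(p−2)`

(`PairShiu.pair_shiu`). This is the special case `Q₁(n) = n`, `Q₂(n) = mn + h` of the
Nair–Tenenbaum bound uniform in the discriminant (Henriot 2012), in the form used by
Matomäki–Merikoski (arXiv:2112.11412, Lemma 3.1); the proof is Shiu's (J. reine angew. Math. 313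
(1980), §5) run on the factorisation of `Q(n) = n(mn+h)` (files `PairShiuClasses`, `PairShiuClassI`,
`PairShiuClassIV`), with the two-dimensional sieve (`LinearFormsPairSieve`) as counting engine and
an Euler-product treatment of the `h`-parts (`PairShiuLocal`). Parameters: `w = X^{1/100}`,
`z = w²`, `Y = w^{1/4}`, `M = 100(K+2)`, `M₁ = 50(K+2)`, `K₁ = 8M₁ log B + 8 log 2`, `L₀ = e^{6K₁}`.

## References

* P. Shiu, J. reine angew. Math. 313 (1980), 161–170, Theorem 1 and §5. [cite: Shiu1980, Theorem 1]
* K. Matomäki, J. Merikoski, IMRN 2023 (arXiv:2112.11412), Lemma 3.1. [cite: MatomakiMerikoski2023, Lemma 3.1]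
-/

noncomputable section

open Finset Real

namespace Literature.NumberTheory.Sieve

namespace PairShiu

/-! ### Small tools -/

/-- `ψ(n) ≤ 2^{ω(n)}`. [folklore] -/
theorem psi_le_two_pow (n : ℕ) :
    ∏ p ∈ n.primeFactors.erase 2, (((p : ℝ) - 1) / ((p : ℝ) - 2)) ≤ (2 : ℝ) ^ #n.primeFactors := by
  calc ∏ p ∈ n.primeFactors.erase 2, (((p : ℝ) - 1) / ((p : ℝ) - 2))
      ≤ ∏ p ∈ n.primeFactors.erase 2, (2 : ℝ) := by
        refine Finset.prod_le_prod (fun p hp => ?_) fun p hp => ?_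
        · rw [Finset.mem_erase] at hp
          exact zero_le_one.trans (PairShiuLocal.psi_factor_bounds (Nat.prime_of_mem_primeFactors hp.2) hp.1).1
        · rw [Finset.mem_erase] at hp
          exact (PairShiuLocal.psi_factor_bounds (Nat.prime_of_mem_primeFactors hp.2) hp.1).2
    _ = (2 : ℝ) ^ #(n.primeFactors.erase 2) := Finset.prod_const 2
    _ ≤ (2 : ℝ) ^ #n.primeFactors := pow_le_pow_right₀ (by norm_num) (Finset.card_le_card (Finset.erase_subset _ _))

/-- `2^{ω(n)} ≤ τ(n)` for `n ≠ 0`. [folklore] -/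
theorem two_pow_card_primeFactors_le (n : ℕ) (hn : n ≠ 0) : (2 : ℝ) ^ #n.primeFactors ≤ #n.divisors := by
  rw [Nat.card_divisors hn, ← Finset.prod_const]
  push_cast
  refine Finset.prod_le_prod (fun _ _ => by norm_num) fun p hp => ?_
  have h1 : 1 ≤ n.factorization p := by
    rw [← (Nat.prime_of_mem_primeFactors hp).dvd_iff_one_le_factorization hn]
    exact Nat.dvd_of_mem_primeFactors hp
  have : (1 : ℝ) ≤ n.factorization p := by exact_mod_cast h1
  linarith

/-- **`ψ(n), 2^{ω(n)} ≤ C(ε) n^ε`** (the divisor bound). [folklore] -/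
theorem exists_two_pow_card_primeFactors_le {ε : ℝ} (hε : 0 < ε) :
    ∃ C : ℝ, 1 ≤ C ∧ ∀ n : ℕ, 1 ≤ n → (2 : ℝ) ^ #n.primeFactors ≤ C * (n : ℝ) ^ ε := by
  obtain ⟨C, hC1, hC⟩ := exists_sigma_zero_le_mul_rpow hε
  refine ⟨C, hC1, fun n hn => ?_⟩
  have h1 := two_pow_card_primeFactors_le n (by omega)
  have h2 := hC n
  rw [ArithmeticFunction.sigma_zero_apply] at h2
  exact h1.trans h2

/-- `∑_{n ∈ S} 1/n² ≤ 1` over integers `≥ 2`. [folklore] -/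
theorem sum_inv_sq_le_one (S : Finset ℕ) (hS : ∀ n ∈ S, 2 ≤ n) : ∑ n ∈ S, 1 / (n : ℝ) ^ 2 ≤ 1 := by
  have hpt : ∀ n : ℕ, 2 ≤ n → 1 / (n : ℝ) ^ 2 ≤ 1 / ((n : ℝ) - 1) - 1 / n := by
    intro n hn
    have hn' : (2 : ℝ) ≤ n := by exact_mod_cast hn
    rw [div_sub_div _ _ (by linarith) (by linarith), div_le_div_iff₀ (by positivity) (by nlinarith)]
    nlinarith
  rcases S.eq_empty_or_nonempty with rfl | hne
  · simp
  set M := S.max' hne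
  have hsub : S ⊆ Icc 2 M := fun n hn => Finset.mem_Icc.mpr ⟨hS n hn, Finset.le_max' S n hn⟩
  calc ∑ n ∈ S, 1 / (n : ℝ) ^ 2 ≤ ∑ n ∈ Icc 2 M, 1 / (n : ℝ) ^ 2 :=
        Finset.sum_le_sum_of_subset_of_nonneg hsub fun n _ _ => by positivity
    _ ≤ ∑ n ∈ Icc 2 M, (1 / ((n : ℝ) - 1) - 1 / n) := Finset.sum_le_sum fun n hn => hpt n (Finset.mem_Icc.mp hn).1
    _ ≤ 1 := by
        have htel : ∀ K : ℕ, ∑ n ∈ Icc 2 (K + 1), (1 / ((n : ℝ) - 1) - 1 / n) = 1 - 1 / ((K + 1 : ℕ) : ℝ) := by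
          intro K
          induction K with
          | zero => simp
          | succ K ih =>
            rw [Finset.sum_Icc_succ_top (by omega), ih]
            push_cast
            field_simp
            ring
        rcases Nat.exists_eq_succ_of_ne_zero (show M ≠ 0 by
          have := hS _ (Finset.max'_mem S hne); omega) with ⟨K, hK⟩
        rw [hK, htel K]
        have : 0 ≤ 1 / ((K + 1 : ℕ) : ℝ) := by positivity
        linarith

/-- The prime sums of `f̂ = fψ`: `∑_{p ∈ s} f(p)ψ(p)/p ≤ ∑_{p ∈ s} f(p)/p + 3B` for primes `s` and
`0 ≤ f(p) ≤ B`. [folklore] -/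
theorem sum_fpsi_div_le {f : ℕ → ℝ} (hf0 : ∀ n, 0 ≤ f n) {B : ℝ} (hB : 0 ≤ B)
    (hfB : ∀ p : ℕ, p.Prime → f p ≤ B) {s : Finset ℕ} (hs : ∀ p ∈ s, p.Prime) :
    ∑ p ∈ s, f p * (∏ q ∈ p.primeFactors.erase 2, (((q : ℝ) - 1) / ((q : ℝ) - 2))) / p ≤
      ∑ p ∈ s, f p / p + 3 * B := by
  have hpt : ∀ p ∈ s, f p * (∏ q ∈ p.primeFactors.erase 2, (((q : ℝ) - 1) / ((q : ℝ) - 2))) / p ≤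
      f p / p + 3 * B * (1 / (p : ℝ) ^ 2) := by
    intro p hp
    have hpp := hs p hp
    have hp0 : (0 : ℝ) < p := by exact_mod_cast hpp.pos
    rw [Nat.Prime.primeFactors hpp]
    by_cases h2 : p = 2
    · subst h2
      simp only [Finset.erase_singleton, Finset.prod_empty, mul_one]
      have : 0 ≤ 3 * B * (1 / ((2 : ℕ) : ℝ) ^ 2) := by positivity
      linarith
    · rw [Finset.erase_eq_of_notMem (by simpa using Ne.symm h2), Finset.prod_singleton]
      have hp3 : (3 : ℝ) ≤ p := by
        exact_mod_cast (Nat.succ_le_of_lt (lt_of_le_of_ne hpp.two_le (Ne.symm h2)))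
      -- `(p-1)/(p-2) = 1 + 1/(p-2) ≤ 1 + 3/p`
      have hψ : ((p : ℝ) - 1) / ((p : ℝ) - 2) ≤ 1 + 3 / p := by
        rw [div_le_iff₀ (by linarith)]
        have : (1 + 3 / (p : ℝ)) * ((p : ℝ) - 2) = (p : ℝ) + 1 - 6 / p := by field_simp; ring
        rw [this]
        have : 6 / (p : ℝ) ≤ 2 := by rw [div_le_iff₀ hp0]; linarith
        linarith
      have hfp := hf0 p
      calc f p * (((p : ℝ) - 1) / ((p : ℝ) - 2)) / p ≤ f p * (1 + 3 / p) / p := by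
            gcongr
        _ = f p / p + 3 * f p * (1 / (p : ℝ) ^ 2) := by field_simp
        _ ≤ f p / p + 3 * B * (1 / (p : ℝ) ^ 2) := by
            gcongr
            exact hfB p hpp
  refine (Finset.sum_le_sum hpt).trans ?_
  rw [Finset.sum_add_distrib, ← Finset.mul_sum]
  have := sum_inv_sq_le_one s fun p hp => (hs p hp).two_le
  nlinarith

/-- `∑_{A ∪ B} F ≤ ∑_A F + ∑_B F` for `F ≥ 0`. [folklore] -/
theorem sum_union_le_add {F : ℕ → ℝ} (hF : ∀ n, 0 ≤ F n) (A B : Finset ℕ) :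
    ∑ n ∈ A ∪ B, F n ≤ ∑ n ∈ A, F n + ∑ n ∈ B, F n := by
  rw [← Finset.sum_union_inter]
  have : 0 ≤ ∑ n ∈ A ∩ B, F n := Finset.sum_nonneg fun n _ => hF n
  linarith


/-! ### The cover of `[1, N]` by the classes -/

/-- **The class decomposition.** For `F ≥ 0`, every `1 ≤ n ≤ N` falls into one of the six classes
(small `Q(n) ≤ z`; large `h`-part; I: `P_n > w`; II: `P_n ≤ w`, `c ≤ w`; III: `P_n ≤ L₀`, `c > w`;
IV: `L₀ < P_n ≤ w`, `c > w`), so `∑_{n ≤ N} F ≤ ∑_{small} F + ∑_H F + ∑_I F + ∑_{II} F + ∑_{III} F + ∑_{IV} F`.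
[cite: Shiu1980, §5] -/
theorem sum_le_sum_classes {F : ℕ → ℝ} (hF : ∀ n, 0 ≤ F n) (N m h : ℕ) (w L₀ Y : ℝ) :
    ∑ n ∈ Icc 1 N, F n ≤
      ∑ n ∈ (Icc 1 N).filter (fun n : ℕ => ((n * (m * n + h) : ℕ) : ℝ) ≤ w * w), F n +
      ∑ n ∈ (Icc 1 N).filter (fun n : ℕ =>
        Y < ((∏ q ∈ h.primeFactors, q ^ n.factorization q : ℕ) : ℝ) ∨
        Y < ((∏ q ∈ h.primeFactors, q ^ (m * n + h).factorization q : ℕ) : ℝ)), F n +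
      ∑ n ∈ (Icc 1 N).filter (fun n : ℕ => w * w < ((n * (m * n + h) : ℕ) : ℝ) ∧
        w < (Shiu.cutPrime (w * w) (n * (m * n + h)) : ℝ)), F n +
      ∑ n ∈ (Icc 1 N).filter (fun n : ℕ => w * w < ((n * (m * n + h) : ℕ) : ℝ) ∧
        (Shiu.cutPrime (w * w) (n * (m * n + h)) : ℝ) ≤ w ∧
        (Shiu.cPart (w * w) (n * (m * n + h)) : ℝ) ≤ w), F n +
      ∑ n ∈ (Icc 1 N).filter (fun n : ℕ => w * w < ((n * (m * n + h) : ℕ) : ℝ) ∧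
        (Shiu.cutPrime (w * w) (n * (m * n + h)) : ℝ) ≤ L₀ ∧
        w < (Shiu.cPart (w * w) (n * (m * n + h)) : ℝ) ∧
        ((∏ q ∈ h.primeFactors, q ^ n.factorization q : ℕ) : ℝ) ≤ Y ∧
        ((∏ q ∈ h.primeFactors, q ^ (m * n + h).factorization q : ℕ) : ℝ) ≤ Y), F n +
      ∑ n ∈ (Icc 1 N).filter (fun n : ℕ => w * w < ((n * (m * n + h) : ℕ) : ℝ) ∧
        L₀ < (Shiu.cutPrime (w * w) (n * (m * n + h)) : ℝ) ∧
        (Shiu.cutPrime (w * w) (n * (m * n + h)) : ℝ) ≤ w ∧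
        w < (Shiu.cPart (w * w) (n * (m * n + h)) : ℝ) ∧
        ((∏ q ∈ h.primeFactors, q ^ n.factorization q : ℕ) : ℝ) ≤ Y ∧
        ((∏ q ∈ h.primeFactors, q ^ (m * n + h).factorization q : ℕ) : ℝ) ≤ Y), F n := by
  set S0 := (Icc 1 N).filter (fun n : ℕ => ((n * (m * n + h) : ℕ) : ℝ) ≤ w * w) with hS0
  set SH := (Icc 1 N).filter (fun n : ℕ =>
        Y < ((∏ q ∈ h.primeFactors, q ^ n.factorization q : ℕ) : ℝ) ∨
        Y < ((∏ q ∈ h.primeFactors, q ^ (m * n + h).factorization q : ℕ) : ℝ)) with hSH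
  set S1 := (Icc 1 N).filter (fun n : ℕ => w * w < ((n * (m * n + h) : ℕ) : ℝ) ∧
        w < (Shiu.cutPrime (w * w) (n * (m * n + h)) : ℝ)) with hS1
  set S2 := (Icc 1 N).filter (fun n : ℕ => w * w < ((n * (m * n + h) : ℕ) : ℝ) ∧
        (Shiu.cutPrime (w * w) (n * (m * n + h)) : ℝ) ≤ w ∧
        (Shiu.cPart (w * w) (n * (m * n + h)) : ℝ) ≤ w) with hS2
  set S3 := (Icc 1 N).filter (fun n : ℕ => w * w < ((n * (m * n + h) : ℕ) : ℝ) ∧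
        (Shiu.cutPrime (w * w) (n * (m * n + h)) : ℝ) ≤ L₀ ∧
        w < (Shiu.cPart (w * w) (n * (m * n + h)) : ℝ) ∧
        ((∏ q ∈ h.primeFactors, q ^ n.factorization q : ℕ) : ℝ) ≤ Y ∧
        ((∏ q ∈ h.primeFactors, q ^ (m * n + h).factorization q : ℕ) : ℝ) ≤ Y) with hS3
  set S4 := (Icc 1 N).filter (fun n : ℕ => w * w < ((n * (m * n + h) : ℕ) : ℝ) ∧
        L₀ < (Shiu.cutPrime (w * w) (n * (m * n + h)) : ℝ) ∧
        (Shiu.cutPrime (w * w) (n * (m * n + h)) : ℝ) ≤ w ∧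
        w < (Shiu.cPart (w * w) (n * (m * n + h)) : ℝ) ∧
        ((∏ q ∈ h.primeFactors, q ^ n.factorization q : ℕ) : ℝ) ≤ Y ∧
        ((∏ q ∈ h.primeFactors, q ^ (m * n + h).factorization q : ℕ) : ℝ) ≤ Y) with hS4
  have hcover : Icc 1 N ⊆ S0 ∪ SH ∪ S1 ∪ S2 ∪ S3 ∪ S4 := by
    intro n hn
    simp only [Finset.mem_union]
    by_cases h0 : ((n * (m * n + h) : ℕ) : ℝ) ≤ w * w
    · exact Or.inl (Or.inl (Or.inl (Or.inl (Or.inl (Finset.mem_filter.mpr ⟨hn, h0⟩)))))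
    push Not at h0
    by_cases hH : Y < ((∏ q ∈ h.primeFactors, q ^ n.factorization q : ℕ) : ℝ) ∨
        Y < ((∏ q ∈ h.primeFactors, q ^ (m * n + h).factorization q : ℕ) : ℝ)
    · exact Or.inl (Or.inl (Or.inl (Or.inl (Or.inr (Finset.mem_filter.mpr ⟨hn, hH⟩)))))
    push Not at hH
    by_cases h1 : w < (Shiu.cutPrime (w * w) (n * (m * n + h)) : ℝ)
    · exact Or.inl (Or.inl (Or.inl (Or.inr (Finset.mem_filter.mpr ⟨hn, h0, h1⟩))))
    push Not at h1
    by_cases h2 : (Shiu.cPart (w * w) (n * (m * n + h)) : ℝ) ≤ w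
    · exact Or.inl (Or.inl (Or.inr (Finset.mem_filter.mpr ⟨hn, h0, h1, h2⟩)))
    push Not at h2
    by_cases h3 : (Shiu.cutPrime (w * w) (n * (m * n + h)) : ℝ) ≤ L₀
    · exact Or.inl (Or.inr (Finset.mem_filter.mpr ⟨hn, h0, h3, h2, hH.1, hH.2⟩))
    push Not at h3
    exact Or.inr (Finset.mem_filter.mpr ⟨hn, h0, h3, h1, h2, hH.1, hH.2⟩)
  calc ∑ n ∈ Icc 1 N, F n ≤ ∑ n ∈ S0 ∪ SH ∪ S1 ∪ S2 ∪ S3 ∪ S4, F n :=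
        Finset.sum_le_sum_of_subset_of_nonneg hcover fun n _ _ => hF n
    _ ≤ ∑ n ∈ S0 ∪ SH ∪ S1 ∪ S2 ∪ S3, F n + ∑ n ∈ S4, F n := sum_union_le_add hF _ _
    _ ≤ ∑ n ∈ S0 ∪ SH ∪ S1 ∪ S2, F n + ∑ n ∈ S3, F n + ∑ n ∈ S4, F n := by
        linarith [sum_union_le_add hF (S0 ∪ SH ∪ S1 ∪ S2) S3]
    _ ≤ ∑ n ∈ S0 ∪ SH ∪ S1, F n + ∑ n ∈ S2, F n + ∑ n ∈ S3, F n + ∑ n ∈ S4, F n := by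
        linarith [sum_union_le_add hF (S0 ∪ SH ∪ S1) S2]
    _ ≤ ∑ n ∈ S0 ∪ SH, F n + ∑ n ∈ S1, F n + ∑ n ∈ S2, F n + ∑ n ∈ S3, F n + ∑ n ∈ S4, F n := by
        linarith [sum_union_le_add hF (S0 ∪ SH) S1]
    _ ≤ ∑ n ∈ S0, F n + ∑ n ∈ SH, F n + ∑ n ∈ S1, F n + ∑ n ∈ S2, F n + ∑ n ∈ S3, F n +
          ∑ n ∈ S4, F n := by
        linarith [sum_union_le_add hF S0 SH]


/-! ### The threshold `X₀` -/

/-- The numerical thresholds: for `X ≥ X₀(Kj)`: `X ≥ 2^{100}`, `log² X ≤ X^{1/2}`,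
`Kj X^{9995/10000} log² X ≤ X` and `1 ≤ log X`. [folklore] -/
theorem exists_threshold (Kj : ℝ) : ∃ X₀ : ℝ, ∀ X : ℝ, X₀ ≤ X →
    (2 : ℝ) ^ (100 : ℕ) ≤ X ∧ 1 ≤ Real.log X ∧ Real.log X ^ 2 ≤ X ^ (1 / 2 : ℝ) ∧
    Kj * X ^ (9995 / 10000 : ℝ) * Real.log X ^ 2 ≤ X := by
  have h1 := Shiu.eventually_mul_rpow_mul_log_le 1 (show (0 : ℝ) < 1 / 10000 by norm_num)
  have h2 := Shiu.eventually_mul_rpow_mul_log_le (max Kj 0) (show (9996 / 10000 : ℝ) < 1 by norm_num)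
  have h3 := Shiu.eventually_mul_rpow_mul_log_le 1 (show (0 : ℝ) < 1 / 4 by norm_num)
  have h4 : ∀ᶠ X : ℝ in Filter.atTop, (2 : ℝ) ^ (100 : ℕ) ≤ X := Filter.eventually_ge_atTop _
  have h5 : ∀ᶠ X : ℝ in Filter.atTop, Real.exp 1 ≤ X := Filter.eventually_ge_atTop _
  obtain ⟨X₀, hX₀⟩ := Filter.eventually_atTop.mp (h1.and (h2.and (h3.and (h4.and h5))))
  refine ⟨X₀, fun X hX => ?_⟩
  obtain ⟨a1, a2, a3, a4, a5⟩ := hX₀ X hX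
  have hX1 : 1 < X := lt_of_lt_of_le (by have := Real.add_one_le_exp (1 : ℝ); linarith) a5
  have hX0 : 0 < X := by linarith
  have hlog1 : 1 ≤ Real.log X := by
    rw [← Real.log_exp 1]; exact Real.log_le_log (Real.exp_pos 1) a5
  have hlog0 : 0 ≤ Real.log X := by linarith
  rw [Real.rpow_zero, one_mul, one_mul] at a1 a3
  refine ⟨a4, hlog1, ?_, ?_⟩
  · calc Real.log X ^ 2 = Real.log X * Real.log X := pow_two _
      _ ≤ X ^ (1 / 4 : ℝ) * X ^ (1 / 4 : ℝ) := mul_le_mul a3 a3 hlog0 (by positivity)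
      _ = X ^ (1 / 2 : ℝ) := by rw [← Real.rpow_add hX0]; norm_num
  · have hK : Kj ≤ max Kj 0 := le_max_left _ _
    calc Kj * X ^ (9995 / 10000 : ℝ) * Real.log X ^ 2
        ≤ (max Kj 0) * X ^ (9995 / 10000 : ℝ) * Real.log X ^ 2 := by
          gcongr
      _ = (max Kj 0) * (X ^ (9995 / 10000 : ℝ) * Real.log X) * Real.log X := by ring
      _ ≤ (max Kj 0) * (X ^ (9995 / 10000 : ℝ) * X ^ (1 / 10000 : ℝ)) * Real.log X := by
          gcongr
      _ = (max Kj 0) * X ^ (9996 / 10000 : ℝ) * Real.log X := by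
          rw [← Real.rpow_add hX0]; norm_num
      _ ≤ X ^ (1 : ℝ) := a2
      _ = X := Real.rpow_one X


/-! ### The theorem -/

set_option maxHeartbeats 4000000 in
/-- **A Brun–Titchmarsh theorem for the pair of linear forms `(n, mn + h)`** (the case
`Q₁(n) = n`, `Q₂(n) = mn + h` of the Nair–Tenenbaum–Henriot bound, by Shiu's method). Given
`K ∈ ℕ`, `B ≥ 1` and `A₂ : ℝ → ℝ` there are `C, X₀` such that for all `f, g ≥ 0` multiplicative on
coprime arguments with `f(1) = g(1) = 1`, `f(p^l), g(p^l) ≤ B^l`, `f(n), g(n) ≤ A₂(δ) n^δ`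
(`δ > 0`), all `X ≥ X₀` and `1 ≤ m ≤ X^K`, `1 ≤ h ≤ X^K` with `(m, h) = 1`:
`∑_{n ≤ X} f(n) g(mn+h) ≤ C ψ(h)ψ(m) ∏_{p ∣ h}(1 + 4f(p)g(p)/p) (X/log² X)
exp(∑_{p ≤ X} f(p)/p + ∑_{p ≤ X} g(p)/p)`, `ψ(k) = ∏_{p ∣ k, p ≠ 2}(p−1)/(p−2)`.
[cite: Shiu1980, Theorem 1] [cite: MatomakiMerikoski2023, Lemma 3.1] -/
theorem pair_shiu (K : ℕ) {B : ℝ} (hB1 : 1 ≤ B) (A₂ : ℝ → ℝ) :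
    ∃ C X₀ : ℝ, 0 < C ∧ ∀ (f g : ℕ → ℝ), (∀ n, 0 ≤ f n) → (∀ n, 0 ≤ g n) → f 1 = 1 → g 1 = 1 →
      (∀ a b : ℕ, a.Coprime b → f (a * b) = f a * f b) →
      (∀ a b : ℕ, a.Coprime b → g (a * b) = g a * g b) →
      (∀ p l : ℕ, p.Prime → 1 ≤ l → f (p ^ l) ≤ B ^ l) →
      (∀ p l : ℕ, p.Prime → 1 ≤ l → g (p ^ l) ≤ B ^ l) →
      (∀ δ : ℝ, 0 < δ → ∀ n : ℕ, 1 ≤ n → f n ≤ A₂ δ * (n : ℝ) ^ δ) →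
      (∀ δ : ℝ, 0 < δ → ∀ n : ℕ, 1 ≤ n → g n ≤ A₂ δ * (n : ℝ) ^ δ) →
      ∀ (X : ℝ) (m h : ℕ), X₀ ≤ X → 1 ≤ m → (m : ℝ) ≤ X ^ K → 1 ≤ h → (h : ℝ) ≤ X ^ K →
        m.Coprime h →
        ∑ n ∈ Icc 1 ⌊X⌋₊, f n * g (m * n + h) ≤
          C * (∏ p ∈ h.primeFactors.erase 2, (((p : ℝ) - 1) / ((p : ℝ) - 2))) *
            (∏ p ∈ m.primeFactors.erase 2, (((p : ℝ) - 1) / ((p : ℝ) - 2))) *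
            (∏ p ∈ h.primeFactors, (1 + 4 * f p * g p / p)) * (X / Real.log X ^ 2) *
            Real.exp (∑ p ∈ (Icc 1 ⌊X⌋₊).filter Nat.Prime, f p / p +
              ∑ p ∈ (Icc 1 ⌊X⌋₊).filter Nat.Prime, g p / p) := by
  -- constants
  obtain ⟨C₃, hC₃, hIII⟩ := class_III_le
  obtain ⟨C₁, hC₁, hI⟩ := class_I_le
  obtain ⟨C₄, hC₄, hIV⟩ := class_IV_le
  obtain ⟨Cτ, hCτ1, hCτ⟩ := exists_two_pow_card_primeFactors_le (show (0 : ℝ) < 1 / 12 by norm_num)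
  set δ : ℝ := 1 / (10000 * ((K : ℝ) + 2)) with hδ
  have hδ0 : 0 < δ := by positivity
  set δ' : ℝ := 1 / (10000 * ((K : ℝ) + 1)) with hδ'
  have hδ'0 : 0 < δ' := by positivity
  obtain ⟨Cω, hCω1, hCω⟩ := exists_two_pow_card_primeFactors_le hδ'0
  set Ac : ℝ := max (A₂ δ) 1 with hAc
  set A : ℝ := max (A₂ (1 / 12)) 1 * Cτ with hA
  set Â : ℝ := max (A₂ (1 / 8)) 1 with hÂ
  set M : ℕ := 100 * (K + 2) with hM
  set M₁ : ℕ := 50 * (K + 2) with hM₁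
  set K₁ : ℝ := 8 * M₁ * Real.log B + 8 * Real.log 2 with hK₁
  set L₀ : ℝ := Real.exp (6 * K₁) with hL₀
  set cΛ : ℝ := 6 * B + 4 * B * Real.exp K₁ * (K₁ + 1) + 2 * Shiu.K₅ A (2 * B) with hcΛ
  set cE : ℝ := 6 * B + 2 * Shiu.K₅ A (2 * B) with hcE
  -- the junk constant and the main constant
  set Kj : ℝ := 2 * Ac ^ 2 + (6 * Ac ^ 2 * Cω ^ 2 + 2 * Ac ^ 2) + (28 * Ac ^ 2 + 4 * Ac ^ 2 * Cω + 2 * Ac ^ 2) +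
      2 * Ac ^ 2 * C₃ * ((16 : ℝ) ^ (⌊L₀⌋₊ + 1) + 1) + 2 * C₁ * B ^ (2 * M) * A ^ 2 +
      2 * C₄ * B ^ (2 * M₁) * Real.exp (640 * Â ^ 2) * Real.exp cΛ with hKj
  set Cmain : ℝ := C₁ * B ^ (2 * M) * (4 * 10000) * Real.exp (640 * Â ^ 2) * Real.exp cE +
      C₄ * B ^ (2 * M₁) * 2500 * Real.exp (640 * Â ^ 2) * Real.exp cΛ with hCmain
  obtain ⟨X₀, hX₀⟩ := exists_threshold Kj
  have hB0 : 0 < B := by linarith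
  have hK₁0 : 0 ≤ K₁ := by
    have := Real.log_nonneg hB1; have := Real.log_pos one_lt_two; positivity
  have hKj0 : 0 ≤ Kj := by positivity
  refine ⟨Cmain + Kj, X₀, by positivity, ?_⟩
  intro f g hf0 hg0 hf1 hg1 hfmul hgmul hfB hgB hfA₂ hgA₂ X m h hX hm hmX hh hhX hmh
  obtain ⟨hX2, hlog1, hlogsq, hjunk⟩ := hX₀ X hX
  -- basic facts about `X`
  have hX4 : (4 : ℝ) ≤ X := le_trans (by norm_num) hX2
  have hX1 : (1 : ℝ) ≤ X := by linarith
  have hX0 : 0 < X := by linarith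
  have hlog0 : 0 < Real.log X := by linarith
  set N : ℕ := ⌊X⌋₊ with hN
  have hNX : (N : ℝ) ≤ X := Nat.floor_le hX0.le
  have hN1 : 1 ≤ N := Nat.le_floor (by simpa using hX1)
  -- the parameters
  set w : ℝ := X ^ (1 / 100 : ℝ) with hw
  set Y : ℝ := w ^ (1 / 4 : ℝ) with hY
  have hw0 : 0 < w := Real.rpow_pos_of_pos hX0 _
  have hw2 : 2 ≤ w := by
    rw [hw]
    calc (2 : ℝ) = ((2 : ℝ) ^ (100 : ℕ)) ^ (1 / 100 : ℝ) := by
          rw [← Real.rpow_natCast, ← Real.rpow_mul (by norm_num)]; norm_num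
      _ ≤ X ^ (1 / 100 : ℝ) := Real.rpow_le_rpow (by positivity) hX2 (by norm_num)
  have hlogw : Real.log w = Real.log X / 100 := by rw [hw, Real.log_rpow hX0]; ring
  have hlogz : Real.log (w * w) = Real.log X / 50 := by rw [Real.log_mul hw0.ne' hw0.ne', hlogw]; ring
  have hY1 : 1 ≤ Y := Real.one_le_rpow (by linarith) (by norm_num)
  have hYw : Y ≤ w ^ (1 / 4 : ℝ) := le_rfl
  have hL₀4 : 4 ≤ L₀ := by
    rw [hL₀]
    have h48 : Real.log 4 ≤ 6 * K₁ := by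
      have : Real.log 4 = 2 * Real.log 2 := by
        rw [show (4 : ℝ) = 2 ^ 2 by norm_num, Real.log_pow]; ring
      rw [this, hK₁]
      have h1 : 0 ≤ 8 * (M₁ : ℝ) * Real.log B := by have := Real.log_nonneg hB1; positivity
      have h2 := Real.log_pos one_lt_two
      linarith
    calc (4 : ℝ) = Real.exp (Real.log 4) := (Real.exp_log (by norm_num)).symm
      _ ≤ Real.exp (6 * K₁) := Real.exp_le_exp.2 h48
  have hLK : 6 * (8 * M₁ * Real.log B + 8 * Real.log 2) ≤ Real.log L₀ := by
    rw [hL₀, Real.log_exp]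
  -- powers of `X`
  have hpowX : ∀ {a b : ℝ}, a ≤ b → X ^ a ≤ X ^ b := fun hab => Real.rpow_le_rpow_of_exponent_le hX1 hab
  have hwpow : ∀ t : ℝ, w ^ t = X ^ (t / 100) := by
    intro t; rw [hw, ← Real.rpow_mul hX0.le]; ring_nf
  have hzpow : w * w = X ^ (1 / 50 : ℝ) := by
    rw [hw, ← Real.rpow_add hX0]; norm_num
  have hYpow : Y = X ^ (1 / 400 : ℝ) := by rw [hY, hwpow]; norm_num
  have hsqY : Real.sqrt Y = X ^ (1 / 800 : ℝ) := by
    rw [hYpow, Real.sqrt_eq_rpow, ← Real.rpow_mul hX0.le]; norm_num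
  have hsqw : Real.sqrt w = X ^ (1 / 200 : ℝ) := by
    rw [hw, Real.sqrt_eq_rpow, ← Real.rpow_mul hX0.le]; norm_num
  -- the constants `A₂` are at least `1`
  have hA₂1 : ∀ t : ℝ, 0 < t → 1 ≤ A₂ t := by
    intro t ht
    have := hfA₂ t ht 1 le_rfl
    simpa [hf1] using this
  have hAc_eq : Ac = A₂ δ := max_eq_left (hA₂1 δ hδ0)
  have hÂ_eq : Â = A₂ (1 / 8) := max_eq_left (hA₂1 _ (by norm_num))
  have hA12_eq : max (A₂ (1 / 12)) 1 = A₂ (1 / 12) := max_eq_left (hA₂1 _ (by norm_num))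
  have hAc1 : 1 ≤ Ac := le_max_right _ _
  have hÂ0 : 0 ≤ Â := le_trans zero_le_one (le_max_right _ _)
  -- notation for the weights
  set ψ : ℕ → ℝ := fun k => ∏ p ∈ k.primeFactors.erase 2, (((p : ℝ) - 1) / ((p : ℝ) - 2)) with hψdef
  set ψh : ℝ := ∏ p ∈ h.primeFactors.erase 2, (((p : ℝ) - 1) / ((p : ℝ) - 2)) with hψh
  set ψm : ℝ := ∏ p ∈ m.primeFactors.erase 2, (((p : ℝ) - 1) / ((p : ℝ) - 2)) with hψm
  set Δ : ℝ := ∏ p ∈ h.primeFactors, (1 + 4 * f p * g p / p) with hΔ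
  set Sf : ℝ := ∑ p ∈ (Icc 1 N).filter Nat.Prime, f p / p with hSf
  set Sg : ℝ := ∑ p ∈ (Icc 1 N).filter Nat.Prime, g p / p with hSg
  set G : ℝ := Real.exp (Sf + Sg) with hG
  set T : ℝ := ψh * ψm * Δ * (X / Real.log X ^ 2) * G with hT
  have hψh1 : 1 ≤ ψh := PairShiuLocal.one_le_psi h
  have hψm1 : 1 ≤ ψm := PairShiuLocal.one_le_psi m
  have hΔ1 : 1 ≤ Δ := by
    rw [hΔ]
    refine Finset.one_le_prod fun p _ => ?_
    have := hf0 p; have := hg0 p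
    have : 0 ≤ 4 * f p * g p / p := by positivity
    linarith
  have hSf0 : 0 ≤ Sf := Finset.sum_nonneg fun p _ => div_nonneg (hf0 p) (Nat.cast_nonneg p)
  have hSg0 : 0 ≤ Sg := Finset.sum_nonneg fun p _ => div_nonneg (hg0 p) (Nat.cast_nonneg p)
  have hG1 : 1 ≤ G := Real.one_le_exp (by positivity)
  have hXL : 0 < X / Real.log X ^ 2 := by positivity
  have hT0 : 0 ≤ T := by positivity
  -- `X^{9995/10000} ≤ X/log² X ≤ T`-type facts
  have hKj1 : 1 ≤ Kj := by
    rw [hKj]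
    have h1 : 1 ≤ Ac ^ 2 := one_le_pow₀ hAc1
    have h2 : 0 ≤ (6 * Ac ^ 2 * Cω ^ 2 + 2 * Ac ^ 2) + (28 * Ac ^ 2 + 4 * Ac ^ 2 * Cω + 2 * Ac ^ 2) +
        2 * Ac ^ 2 * C₃ * ((16 : ℝ) ^ (⌊L₀⌋₊ + 1) + 1) + 2 * C₁ * B ^ (2 * M) * A ^ 2 +
        2 * C₄ * B ^ (2 * M₁) * Real.exp (640 * Â ^ 2) * Real.exp cΛ := by positivity
    linarith
  have hmainX : X ^ (9995 / 10000 : ℝ) ≤ X / Real.log X ^ 2 := by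
    rw [le_div_iff₀ (by positivity)]
    have h0 : 0 ≤ X ^ (9995 / 10000 : ℝ) * Real.log X ^ 2 := by positivity
    have h1 : X ^ (9995 / 10000 : ℝ) * Real.log X ^ 2 ≤ Kj * (X ^ (9995 / 10000 : ℝ) * Real.log X ^ 2) :=
      le_mul_of_one_le_left h0 hKj1
    have h2 : Kj * (X ^ (9995 / 10000 : ℝ) * Real.log X ^ 2) = Kj * X ^ (9995 / 10000 : ℝ) * Real.log X ^ 2 := by
      ring
    linarith
  have hTX : X / Real.log X ^ 2 ≤ T := by
    rw [hT]
    calc X / Real.log X ^ 2 = 1 * 1 * 1 * (X / Real.log X ^ 2) * 1 := by ring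
      _ ≤ ψh * ψm * Δ * (X / Real.log X ^ 2) * G := by gcongr
  have hjunkT : ∀ {e : ℝ} {c : ℝ}, 0 ≤ c → e ≤ 9995 / 10000 → c * X ^ e ≤ c * T := fun hc he =>
    mul_le_mul_of_nonneg_left ((hpowX he).trans (hmainX.trans hTX)) hc
  -- Step 1: the pointwise bound `F ≤ Fmax`
  set Fmax : ℝ := 2 * Ac ^ 2 * X ^ (1 / 10000 : ℝ) with hFmax
  have hFmax0 : 0 ≤ Fmax := by positivity
  have hL2 : ∀ n ∈ Icc 1 N, ((m * n + h : ℕ) : ℝ) ≤ 2 * X ^ ((K : ℝ) + 1) := by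
    intro n hn
    have hnN : (n : ℝ) ≤ N := by exact_mod_cast (Finset.mem_Icc.mp hn).2
    have hXK : (1 : ℝ) ≤ X ^ (K : ℝ) := Real.one_le_rpow hX1 (Nat.cast_nonneg K)
    have hXK1 : X ^ ((K : ℝ) + 1) = X ^ (K : ℝ) * X := by rw [Real.rpow_add hX0, Real.rpow_one]
    push_cast
    have hmX' : (m : ℝ) ≤ X ^ (K : ℝ) := by rwa [← Real.rpow_natCast] at hmX
    have hhX' : (h : ℝ) ≤ X ^ (K : ℝ) := by rwa [← Real.rpow_natCast] at hhX
    have h1 : (m : ℝ) * n ≤ X ^ (K : ℝ) * X :=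
      mul_le_mul hmX' (hnN.trans hNX) (Nat.cast_nonneg n) (by positivity)
    have h2 : (h : ℝ) ≤ X ^ (K : ℝ) * X := hhX'.trans (le_mul_of_one_le_right (by positivity) hX1)
    rw [hXK1]; linarith
  have hFpt : ∀ n ∈ Icc 1 N, f n * g (m * n + h) ≤ Fmax := by
    intro n hn
    have hn1 : 1 ≤ n := (Finset.mem_Icc.mp hn).1
    have hnX : (n : ℝ) ≤ X := le_trans (by exact_mod_cast (Finset.mem_Icc.mp hn).2) hNX
    have hf := hfA₂ δ hδ0 n hn1
    have hg := hgA₂ δ hδ0 (m * n + h) (by omega)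
    rw [← hAc_eq] at hf hg
    have h1 : (n : ℝ) ^ δ ≤ X ^ δ := Real.rpow_le_rpow (Nat.cast_nonneg n) hnX hδ0.le
    have h2 : ((m * n + h : ℕ) : ℝ) ^ δ ≤ 2 * X ^ (((K : ℝ) + 1) * δ) := by
      calc ((m * n + h : ℕ) : ℝ) ^ δ ≤ (2 * X ^ ((K : ℝ) + 1)) ^ δ :=
            Real.rpow_le_rpow (Nat.cast_nonneg _) (hL2 n hn) hδ0.le
        _ = 2 ^ δ * X ^ (((K : ℝ) + 1) * δ) := by
            rw [Real.mul_rpow (by norm_num) (by positivity), ← Real.rpow_mul hX0.le]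
        _ ≤ 2 * X ^ (((K : ℝ) + 1) * δ) := by
            refine mul_le_mul_of_nonneg_right ?_ (by positivity)
            calc (2 : ℝ) ^ δ ≤ 2 ^ (1 : ℝ) := Real.rpow_le_rpow_of_exponent_le (by norm_num) ?_
              _ = 2 := Real.rpow_one 2
            rw [hδ, div_le_one (by positivity)]
            have : (0 : ℝ) ≤ K := Nat.cast_nonneg K
            linarith
    have hexp : X ^ δ * X ^ (((K : ℝ) + 1) * δ) = X ^ (1 / 10000 : ℝ) := by
      rw [← Real.rpow_add hX0]
      congr 1
      rw [hδ]; field_simp; ring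
    calc f n * g (m * n + h) ≤ (Ac * (n : ℝ) ^ δ) * (Ac * ((m * n + h : ℕ) : ℝ) ^ δ) :=
          mul_le_mul hf hg (hg0 _) (by positivity)
      _ ≤ (Ac * X ^ δ) * (Ac * (2 * X ^ (((K : ℝ) + 1) * δ))) := by
          refine mul_le_mul (mul_le_mul_of_nonneg_left h1 (by positivity))
            (mul_le_mul_of_nonneg_left h2 (by positivity)) (by positivity) (by positivity)
      _ = 2 * Ac ^ 2 * (X ^ δ * X ^ (((K : ℝ) + 1) * δ)) := by ring
      _ = Fmax := by rw [hexp]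
  -- Step 2: the `ω(h)`-type bounds
  have hhX' : (h : ℝ) ≤ X ^ (K : ℝ) := by rwa [← Real.rpow_natCast] at hhX
  have hKδ' : (K : ℝ) * δ' ≤ 1 / 10000 := by
    rw [hδ', mul_one_div, div_le_div_iff₀ (by positivity) (by norm_num)]
    have : (0 : ℝ) ≤ K := Nat.cast_nonneg K
    linarith
  have h2ω : (2 : ℝ) ^ #h.primeFactors ≤ Cω * X ^ (1 / 10000 : ℝ) := by
    refine (hCω h hh).trans (mul_le_mul_of_nonneg_left ?_ (by linarith))
    calc (h : ℝ) ^ δ' ≤ (X ^ (K : ℝ)) ^ δ' := Real.rpow_le_rpow (Nat.cast_nonneg h) hhX' hδ'0.le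
      _ = X ^ ((K : ℝ) * δ') := by rw [← Real.rpow_mul hX0.le]
      _ ≤ X ^ (1 / 10000 : ℝ) := hpowX hKδ'
  have h4ω : (4 : ℝ) ^ #h.primeFactors ≤ Cω ^ 2 * X ^ (1 / 5000 : ℝ) := by
    have : (4 : ℝ) ^ #h.primeFactors = ((2 : ℝ) ^ #h.primeFactors) ^ 2 := by
      rw [← pow_mul, mul_comm, pow_mul]; norm_num
    rw [this]
    calc ((2 : ℝ) ^ #h.primeFactors) ^ 2 ≤ (Cω * X ^ (1 / 10000 : ℝ)) ^ 2 :=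
          pow_le_pow_left₀ (by positivity) h2ω 2
      _ = Cω ^ 2 * X ^ (1 / 5000 : ℝ) := by
          rw [mul_pow, ← Real.rpow_natCast (X ^ (1 / 10000 : ℝ)), ← Real.rpow_mul hX0.le]; norm_num
  have hω : (#h.primeFactors : ℝ) ≤ Cω * X ^ (1 / 10000 : ℝ) := by
    refine le_trans ?_ h2ω
    have := one_add_mul_le_pow (show (-2 : ℝ) ≤ 1 by norm_num) #h.primeFactors
    norm_num at this
    linarith
  -- Step 3: the four cheap classes
  have hsmall := class_small_le (F := fun n => f n * g (m * n + h)) (m := m) (N := N) hh hFmax0 hFpt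
    (show (0 : ℝ) ≤ w * w by positivity)
  have hHcl := class_H_le (F := fun n => f n * g (m * n + h)) (N := N) (show h ≠ 0 by omega) hmh hFmax0 hFpt hY1
  have hIIcl := class_II_le (F := fun n => f n * g (m * n + h)) (N := N) hh hmh hFmax0 hFpt hw2
  have hIIIcl := hIII (F := fun n => f n * g (m * n + h)) (N := N) hh hm hmh
    (fun n => mul_nonneg (hf0 n) (hg0 _)) hFmax0 hFpt (L₀ := L₀) hw2 hY1
  -- Step 4: classes I and IV
  have hψ2 : ∀ n : ℕ, 1 ≤ n → ψ n ≤ Cτ * (n : ℝ) ^ (1 / 12 : ℝ) := fun n hn =>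
    (psi_le_two_pow n).trans (hCτ n hn)
  have hfA' : ∀ n : ℕ, 1 ≤ n → f n * ψ n ≤ A * (n : ℝ) ^ (1 / 6 : ℝ) := by
    intro n hn
    have hf := hfA₂ (1 / 12) (by norm_num) n hn
    rw [← hA12_eq] at hf
    calc f n * ψ n ≤ (max (A₂ (1 / 12)) 1 * (n : ℝ) ^ (1 / 12 : ℝ)) * (Cτ * (n : ℝ) ^ (1 / 12 : ℝ)) :=
          mul_le_mul hf (hψ2 n hn) (PairShiuLocal.psi_nonneg n) (by positivity)
      _ = A * ((n : ℝ) ^ (1 / 12 : ℝ) * (n : ℝ) ^ (1 / 12 : ℝ)) := by rw [hA]; ring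
      _ = A * (n : ℝ) ^ (1 / 6 : ℝ) := by rw [← Real.rpow_add (by exact_mod_cast hn)]; norm_num
  have hgA' : ∀ n : ℕ, 1 ≤ n → g n * ψ n ≤ A * (n : ℝ) ^ (1 / 6 : ℝ) := by
    intro n hn
    have hg := hgA₂ (1 / 12) (by norm_num) n hn
    rw [← hA12_eq] at hg
    calc g n * ψ n ≤ (max (A₂ (1 / 12)) 1 * (n : ℝ) ^ (1 / 12 : ℝ)) * (Cτ * (n : ℝ) ^ (1 / 12 : ℝ)) :=
          mul_le_mul hg (hψ2 n hn) (PairShiuLocal.psi_nonneg n) (by positivity)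
      _ = A * ((n : ℝ) ^ (1 / 12 : ℝ) * (n : ℝ) ^ (1 / 12 : ℝ)) := by rw [hA]; ring
      _ = A * (n : ℝ) ^ (1 / 6 : ℝ) := by rw [← Real.rpow_add (by exact_mod_cast hn)]; norm_num
  have hfÂ : ∀ p a : ℕ, p.Prime → 1 ≤ a → f (p ^ a) ≤ Â * ((p : ℝ) ^ a) ^ (1 / 8 : ℝ) := by
    intro p a hp _
    have := hfA₂ (1 / 8) (by norm_num) (p ^ a) (Nat.one_le_pow _ _ hp.pos)
    rw [← hÂ_eq] at this
    push_cast at this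
    exact this
  have hgÂ : ∀ p a : ℕ, p.Prime → 1 ≤ a → g (p ^ a) ≤ Â * ((p : ℝ) ^ a) ^ (1 / 8 : ℝ) := by
    intro p a hp _
    have := hgA₂ (1 / 8) (by norm_num) (p ^ a) (Nat.one_le_pow _ _ hp.pos)
    rw [← hÂ_eq] at this
    push_cast at this
    exact this
  -- the ratios `log/log w`, `log/log z`
  have hlogN : Real.log N ≤ Real.log X := Real.log_le_log (by exact_mod_cast hN1) hNX
  have hlog2X : Real.log 2 ≤ Real.log X := Real.log_le_log (by norm_num) (by linarith)
  have hlogL : Real.log ((m * N + h : ℕ) : ℝ) ≤ ((K : ℝ) + 2) * Real.log X := by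
    have h1 := hL2 N (Finset.mem_Icc.mpr ⟨hN1, le_rfl⟩)
    have hpos : (0 : ℝ) < ((m * N + h : ℕ) : ℝ) := by exact_mod_cast (show 0 < m * N + h by omega)
    calc Real.log ((m * N + h : ℕ) : ℝ) ≤ Real.log (2 * X ^ ((K : ℝ) + 1)) := Real.log_le_log hpos h1
      _ = Real.log 2 + ((K : ℝ) + 1) * Real.log X := by
          rw [Real.log_mul (by norm_num) (by positivity), Real.log_rpow hX0]
      _ ≤ ((K : ℝ) + 2) * Real.log X := by linarith
  have hKL : 0 ≤ (K : ℝ) * Real.log X := by positivity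
  have hMr : ((M : ℕ) : ℝ) = 100 * ((K : ℝ) + 2) := by rw [hM]; push_cast; ring
  have hM₁r : ((M₁ : ℕ) : ℝ) = 50 * ((K : ℝ) + 2) := by rw [hM₁]; push_cast; ring
  have hM1 : Real.log N / Real.log w ≤ M := by
    rw [hlogw, div_le_iff₀ (by positivity), hMr]; linarith
  have hM2 : Real.log ((m * N + h : ℕ) : ℝ) / Real.log w ≤ M := by
    rw [hlogw, div_le_iff₀ (by positivity), hMr]; linarith
  have hM1' : Real.log N / Real.log (w * w) ≤ M₁ := by
    rw [hlogz, div_le_iff₀ (by positivity), hM₁r]; linarith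
  have hM2' : Real.log ((m * N + h : ℕ) : ℝ) / Real.log (w * w) ≤ M₁ := by
    rw [hlogz, div_le_iff₀ (by positivity), hM₁r]; linarith
  have hIcl := hI hf0 hg0 hf1 hg1 hfmul hgmul hB1 hfB hgB hfA' hgA' hÂ0 hfÂ hgÂ hm hh hmh hw2 hM1 hM2
  have hIVcl := hIV hf0 hg0 hf1 hg1 hfmul hgmul hB1 hfB hgB hfA' hgA' hÂ0 hfÂ hgÂ hm hh hmh hw2 hL₀4 hY1 hYw
    hM1' hM2' hLK
  -- Step 5: the exponential factors
  have hpBND : ∀ p ∈ Shiu.primesBelowNotDvd ((⌊w * w⌋₊ : ℝ) + 1) 1, p ∈ (Icc 1 N).filter Nat.Prime := by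
    intro p hp
    rw [Shiu.mem_primesBelowNotDvd] at hp
    rw [Finset.mem_filter, Finset.mem_Icc]
    refine ⟨⟨hp.1.one_lt.le, Nat.le_floor ?_⟩, hp.1⟩
    have h1 : (p : ℝ) ≤ ⌊w * w⌋₊ := by
      have : (p : ℝ) < (⌊w * w⌋₊ : ℝ) + 1 := hp.2.1
      exact_mod_cast (show p ≤ ⌊w * w⌋₊ by exact_mod_cast Nat.lt_add_one_iff.mp (by exact_mod_cast this))
    have h2 : (⌊w * w⌋₊ : ℝ) ≤ w * w := Nat.floor_le (by positivity)
    have h3 : w * w ≤ X := by rw [hzpow]; exact (hpowX (by norm_num)).trans (le_of_eq (Real.rpow_one X))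
    linarith
  have hexpf : ∑ p ∈ Shiu.primesBelowNotDvd ((⌊w * w⌋₊ : ℝ) + 1) 1, f p * ψ p / p ≤ Sf + 3 * B := by
    have h1 := sum_fpsi_div_le hf0 hB0.le (fun p hp => by have := hfB p 1 hp le_rfl; rwa [pow_one, pow_one] at this)
      (s := Shiu.primesBelowNotDvd ((⌊w * w⌋₊ : ℝ) + 1) 1) (fun p hp => (Shiu.mem_primesBelowNotDvd.1 hp).1)
    refine h1.trans (add_le_add ?_ le_rfl)
    exact Finset.sum_le_sum_of_subset_of_nonneg hpBND fun p _ _ => div_nonneg (hf0 p) (Nat.cast_nonneg p)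
  have hexpg : ∑ p ∈ Shiu.primesBelowNotDvd ((⌊w * w⌋₊ : ℝ) + 1) 1, g p * ψ p / p ≤ Sg + 3 * B := by
    have h1 := sum_fpsi_div_le hg0 hB0.le (fun p hp => by have := hgB p 1 hp le_rfl; rwa [pow_one, pow_one] at this)
      (s := Shiu.primesBelowNotDvd ((⌊w * w⌋₊ : ℝ) + 1) 1) (fun p hp => (Shiu.mem_primesBelowNotDvd.1 hp).1)
    refine h1.trans (add_le_add ?_ le_rfl)
    exact Finset.sum_le_sum_of_subset_of_nonneg hpBND fun p _ _ => div_nonneg (hg0 p) (Nat.cast_nonneg p)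
  have hEfg : Real.exp (∑ p ∈ Shiu.primesBelowNotDvd ((⌊w * w⌋₊ : ℝ) + 1) 1, f p * ψ p / p + Shiu.K₅ A (2 * B)) *
      Real.exp (∑ p ∈ Shiu.primesBelowNotDvd ((⌊w * w⌋₊ : ℝ) + 1) 1, g p * ψ p / p + Shiu.K₅ A (2 * B)) ≤
      Real.exp cE * G := by
    rw [← Real.exp_add, hG, ← Real.exp_add, Real.exp_le_exp, hcE]
    linarith
  have hΛfg : Real.exp (∑ p ∈ Shiu.primesBelowNotDvd ((⌊w * w⌋₊ : ℝ) + 1) 1, f p * ψ p / p +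
        2 * B * Real.exp (8 * M₁ * Real.log B + 8 * Real.log 2) * ((8 * M₁ * Real.log B + 8 * Real.log 2) + 1) +
        Shiu.K₅ A (2 * B)) *
      Real.exp (∑ p ∈ Shiu.primesBelowNotDvd ((⌊w * w⌋₊ : ℝ) + 1) 1, g p * ψ p / p +
        2 * B * Real.exp (8 * M₁ * Real.log B + 8 * Real.log 2) * ((8 * M₁ * Real.log B + 8 * Real.log 2) + 1) +
        Shiu.K₅ A (2 * B)) ≤ Real.exp cΛ * G := by
    rw [← Real.exp_add, hG, ← Real.exp_add, Real.exp_le_exp, hcΛ, ← hK₁]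
    linarith
  -- Step 6: the six bounds in the common currency `T`
  clear hX2
  have hXpow_mul : ∀ a b : ℝ, X ^ a * X ^ b = X ^ (a + b) := fun a b => (Real.rpow_add hX0 a b).symm
  have hJ1 : ∀ {a : ℝ}, a ≤ 9995 / 10000 → X ^ a ≤ T := fun ha => (hpowX ha).trans (hmainX.trans hTX)
  have hJ2 : ∀ {a b : ℝ}, a + b ≤ 9995 / 10000 → X ^ a * X ^ b ≤ T := fun hab => by
    rw [hXpow_mul]; exact hJ1 hab
  have hJ3 : ∀ {a b c : ℝ}, a + b + c ≤ 9995 / 10000 → X ^ a * X ^ b * X ^ c ≤ T := fun habc => by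
    rw [hXpow_mul, hXpow_mul]; exact hJ1 habc
  have hψψ : 1 ≤ ψh * ψm := one_le_mul_of_one_le_of_one_le hψh1 hψm1
  have hTψ' : ∀ {a : ℝ}, a ≤ 9995 / 10000 → ψh * ψm * X ^ a ≤ T := fun ha => by
    rw [hT]
    calc ψh * ψm * X ^ _ ≤ ψh * ψm * (X / Real.log X ^ 2) :=
          mul_le_mul_of_nonneg_left ((hpowX ha).trans hmainX) (by positivity)
      _ = ψh * ψm * 1 * (X / Real.log X ^ 2) * 1 := by ring
      _ ≤ ψh * ψm * Δ * (X / Real.log X ^ 2) * G := by gcongr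
  have hX1pow : X = X ^ (1 : ℝ) := (Real.rpow_one X).symm
  -- (small)
  have hb0 : Fmax * (w * w) ≤ (2 * Ac ^ 2) * T := by
    rw [hFmax, hzpow]
    calc 2 * Ac ^ 2 * X ^ (1 / 10000 : ℝ) * X ^ (1 / 50 : ℝ) = (2 * Ac ^ 2) * (X ^ (1 / 10000 : ℝ) * X ^ (1 / 50 : ℝ)) := by
          ring
      _ ≤ (2 * Ac ^ 2) * T := mul_le_mul_of_nonneg_left (hJ2 (by norm_num)) (by positivity)
  -- (H)
  have hbH : Fmax * (3 * ((N : ℝ) / Real.sqrt Y * (4 : ℝ) ^ #h.primeFactors) + Y ^ 2) ≤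
      (6 * Ac ^ 2 * Cω ^ 2 + 2 * Ac ^ 2) * T := by
    have h1 : (N : ℝ) / Real.sqrt Y ≤ X ^ (799 / 800 : ℝ) := by
      rw [hsqY, div_le_iff₀ (by positivity), hXpow_mul]
      have : X ^ ((799 / 800 : ℝ) + 1 / 800) = X := by norm_num
      rw [this]; exact hNX
    have h2 : (N : ℝ) / Real.sqrt Y * (4 : ℝ) ^ #h.primeFactors ≤ Cω ^ 2 * (X ^ (799 / 800 : ℝ) * X ^ (1 / 5000 : ℝ)) := by
      calc (N : ℝ) / Real.sqrt Y * (4 : ℝ) ^ #h.primeFactors ≤ X ^ (799 / 800 : ℝ) * (Cω ^ 2 * X ^ (1 / 5000 : ℝ)) :=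
            mul_le_mul h1 h4ω (by positivity) (by positivity)
        _ = Cω ^ 2 * (X ^ (799 / 800 : ℝ) * X ^ (1 / 5000 : ℝ)) := by ring
    have h3 : Y ^ 2 = X ^ (1 / 200 : ℝ) := by
      rw [hYpow, ← Real.rpow_natCast, ← Real.rpow_mul hX0.le]; norm_num
    have hP : Fmax * ((N : ℝ) / Real.sqrt Y * (4 : ℝ) ^ #h.primeFactors) ≤ (2 * Ac ^ 2 * Cω ^ 2) * T := by
      calc Fmax * ((N : ℝ) / Real.sqrt Y * (4 : ℝ) ^ #h.primeFactors)
          ≤ Fmax * (Cω ^ 2 * (X ^ (799 / 800 : ℝ) * X ^ (1 / 5000 : ℝ))) := mul_le_mul_of_nonneg_left h2 hFmax0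
        _ = (2 * Ac ^ 2 * Cω ^ 2) * (X ^ (1 / 10000 : ℝ) * X ^ (799 / 800 : ℝ) * X ^ (1 / 5000 : ℝ)) := by
            rw [hFmax]; ring
        _ ≤ (2 * Ac ^ 2 * Cω ^ 2) * T := mul_le_mul_of_nonneg_left (hJ3 (by norm_num)) (by positivity)
    have hQ : Fmax * Y ^ 2 ≤ (2 * Ac ^ 2) * T := by
      rw [h3, hFmax]
      calc 2 * Ac ^ 2 * X ^ (1 / 10000 : ℝ) * X ^ (1 / 200 : ℝ) = (2 * Ac ^ 2) * (X ^ (1 / 10000 : ℝ) * X ^ (1 / 200 : ℝ)) := by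
            ring
        _ ≤ (2 * Ac ^ 2) * T := mul_le_mul_of_nonneg_left (hJ2 (by norm_num)) (by positivity)
    calc Fmax * (3 * ((N : ℝ) / Real.sqrt Y * (4 : ℝ) ^ #h.primeFactors) + Y ^ 2)
        = 3 * (Fmax * ((N : ℝ) / Real.sqrt Y * (4 : ℝ) ^ #h.primeFactors)) + Fmax * Y ^ 2 := by ring
      _ ≤ 3 * ((2 * Ac ^ 2 * Cω ^ 2) * T) + (2 * Ac ^ 2) * T := by gcongr
      _ = _ := by ring
  -- (II)
  have hbII : Fmax * (2 * N * (7 * w ^ (-(1 / 3 : ℝ)) + #h.primeFactors / Real.sqrt w) + w) ≤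
      (28 * Ac ^ 2 + 4 * Ac ^ 2 * Cω + 2 * Ac ^ 2) * T := by
    have hw3 : w ^ (-(1 / 3 : ℝ)) = X ^ (-(1 / 300 : ℝ)) := by rw [hwpow]; norm_num
    have h1 : Fmax * ((N : ℝ) * w ^ (-(1 / 3 : ℝ))) ≤ (2 * Ac ^ 2) * T := by
      rw [hw3]
      calc Fmax * ((N : ℝ) * X ^ (-(1 / 300 : ℝ))) ≤ Fmax * (X * X ^ (-(1 / 300 : ℝ))) := by gcongr
        _ = (2 * Ac ^ 2) * (X ^ (1 / 10000 : ℝ) * X ^ (1 : ℝ) * X ^ (-(1 / 300 : ℝ))) := by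
            rw [hFmax, Real.rpow_one]; ring
        _ ≤ (2 * Ac ^ 2) * T := mul_le_mul_of_nonneg_left (hJ3 (by norm_num)) (by positivity)
    have h2 : Fmax * ((N : ℝ) * (#h.primeFactors / Real.sqrt w)) ≤ (2 * Ac ^ 2 * Cω) * T := by
      rw [hsqw]
      have hinv : (X ^ (1 / 200 : ℝ))⁻¹ = X ^ (-(1 / 200 : ℝ)) := (Real.rpow_neg hX0.le _).symm
      calc Fmax * ((N : ℝ) * (#h.primeFactors / X ^ (1 / 200 : ℝ)))
          = Fmax * ((N : ℝ) * #h.primeFactors) * (X ^ (1 / 200 : ℝ))⁻¹ := by ring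
        _ ≤ Fmax * (X * (Cω * X ^ (1 / 10000 : ℝ))) * (X ^ (1 / 200 : ℝ))⁻¹ := by
            refine mul_le_mul_of_nonneg_right (mul_le_mul_of_nonneg_left ?_ hFmax0) (by positivity)
            exact mul_le_mul hNX hω (Nat.cast_nonneg _) hX0.le
        _ = (2 * Ac ^ 2 * Cω) * ((X ^ (1 / 10000 : ℝ) * X ^ (1 / 10000 : ℝ)) * X ^ (1 : ℝ) * X ^ (-(1 / 200 : ℝ))) := by
            rw [hFmax, hinv, Real.rpow_one]; ring
        _ = (2 * Ac ^ 2 * Cω) * (X ^ (1 / 10000 + 1 / 10000 : ℝ) * X ^ (1 : ℝ) * X ^ (-(1 / 200 : ℝ))) := by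
            rw [hXpow_mul]
        _ ≤ (2 * Ac ^ 2 * Cω) * T := mul_le_mul_of_nonneg_left (hJ3 (by norm_num)) (by positivity)
    have h3 : Fmax * w ≤ (2 * Ac ^ 2) * T := by
      rw [hFmax, hw]
      calc 2 * Ac ^ 2 * X ^ (1 / 10000 : ℝ) * X ^ (1 / 100 : ℝ) = (2 * Ac ^ 2) * (X ^ (1 / 10000 : ℝ) * X ^ (1 / 100 : ℝ)) := by
            ring
        _ ≤ (2 * Ac ^ 2) * T := mul_le_mul_of_nonneg_left (hJ2 (by norm_num)) (by positivity)
    calc Fmax * (2 * N * (7 * w ^ (-(1 / 3 : ℝ)) + #h.primeFactors / Real.sqrt w) + w)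
        = 14 * (Fmax * ((N : ℝ) * w ^ (-(1 / 3 : ℝ)))) + 2 * (Fmax * ((N : ℝ) * (#h.primeFactors / Real.sqrt w))) +
          Fmax * w := by ring
      _ ≤ 14 * ((2 * Ac ^ 2) * T) + 2 * ((2 * Ac ^ 2 * Cω) * T) + (2 * Ac ^ 2) * T := by gcongr
      _ = _ := by ring
  -- (III)
  have hbIII : Fmax * C₃ * ((N : ℝ) * Y / Real.sqrt w * (16 : ℝ) ^ (⌊L₀⌋₊ + 1) + w ^ 4) ≤
      (2 * Ac ^ 2 * C₃ * ((16 : ℝ) ^ (⌊L₀⌋₊ + 1) + 1)) * T := by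
    have h1 : (N : ℝ) * Y / Real.sqrt w ≤ X ^ (1 : ℝ) * X ^ (1 / 400 : ℝ) * X ^ (-(1 / 200 : ℝ)) := by
      rw [hYpow, hsqw, div_eq_mul_inv, ← Real.rpow_neg hX0.le, ← hX1pow]
      gcongr
    have h2 : w ^ 4 = X ^ (1 / 25 : ℝ) := by
      rw [hw, ← Real.rpow_natCast, ← Real.rpow_mul hX0.le]; norm_num
    have hP : Fmax * C₃ * ((N : ℝ) * Y / Real.sqrt w * (16 : ℝ) ^ (⌊L₀⌋₊ + 1)) ≤
        (2 * Ac ^ 2 * C₃ * (16 : ℝ) ^ (⌊L₀⌋₊ + 1)) * T := by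
      calc Fmax * C₃ * ((N : ℝ) * Y / Real.sqrt w * (16 : ℝ) ^ (⌊L₀⌋₊ + 1))
          ≤ Fmax * C₃ * ((X ^ (1 : ℝ) * X ^ (1 / 400 : ℝ) * X ^ (-(1 / 200 : ℝ))) * (16 : ℝ) ^ (⌊L₀⌋₊ + 1)) := by
            gcongr
        _ = (2 * Ac ^ 2 * C₃ * (16 : ℝ) ^ (⌊L₀⌋₊ + 1)) *
            ((X ^ (1 / 10000 : ℝ) * X ^ (1 : ℝ)) * X ^ (1 / 400 : ℝ) * X ^ (-(1 / 200 : ℝ))) := by rw [hFmax]; ring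
        _ = (2 * Ac ^ 2 * C₃ * (16 : ℝ) ^ (⌊L₀⌋₊ + 1)) *
            (X ^ (1 / 10000 + 1 : ℝ) * X ^ (1 / 400 : ℝ) * X ^ (-(1 / 200 : ℝ))) := by rw [hXpow_mul]
        _ ≤ (2 * Ac ^ 2 * C₃ * (16 : ℝ) ^ (⌊L₀⌋₊ + 1)) * T :=
            mul_le_mul_of_nonneg_left (hJ3 (by norm_num)) (by positivity)
    have hQ : Fmax * C₃ * w ^ 4 ≤ (2 * Ac ^ 2 * C₃) * T := by
      rw [h2, hFmax]
      calc 2 * Ac ^ 2 * X ^ (1 / 10000 : ℝ) * C₃ * X ^ (1 / 25 : ℝ) =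
          (2 * Ac ^ 2 * C₃) * (X ^ (1 / 10000 : ℝ) * X ^ (1 / 25 : ℝ)) := by ring
        _ ≤ (2 * Ac ^ 2 * C₃) * T := mul_le_mul_of_nonneg_left (hJ2 (by norm_num)) (by positivity)
    calc Fmax * C₃ * ((N : ℝ) * Y / Real.sqrt w * (16 : ℝ) ^ (⌊L₀⌋₊ + 1) + w ^ 4)
        = Fmax * C₃ * ((N : ℝ) * Y / Real.sqrt w * (16 : ℝ) ^ (⌊L₀⌋₊ + 1)) + Fmax * C₃ * w ^ 4 := by ring
      _ ≤ (2 * Ac ^ 2 * C₃ * (16 : ℝ) ^ (⌊L₀⌋₊ + 1)) * T + (2 * Ac ^ 2 * C₃) * T := add_le_add hP hQ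
      _ = _ := by ring
  -- (I)
  have hV : ∏ p ∈ (Nat.primesBelow ⌈w⌉₊).erase 2, (1 - 2 / (p : ℝ)) ≤ 40000 / Real.log X ^ 2 := by
    have := oddDensity_le hw2
    rw [hlogw] at this
    have h : 4 / (Real.log X / 100) ^ 2 = 40000 / Real.log X ^ 2 := by field_simp; norm_num
    rwa [h] at this
  have hbI : C₁ * B ^ (2 * M) *
      ((∏ p ∈ (Nat.primesBelow ⌈w⌉₊).erase 2, (1 - 2 / (p : ℝ))) * ψh * ψm * N *
        (Real.exp (640 * Â ^ 2) * Δ) *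
        (Real.exp (∑ p ∈ Shiu.primesBelowNotDvd ((⌊w * w⌋₊ : ℝ) + 1) 1, f p * ψ p / p + Shiu.K₅ A (2 * B)) *
         Real.exp (∑ p ∈ Shiu.primesBelowNotDvd ((⌊w * w⌋₊ : ℝ) + 1) 1, g p * ψ p / p + Shiu.K₅ A (2 * B))) +
      A ^ 2 * (w * w) ^ (1 / 3 : ℝ) * (w * w) ^ 2 * (ψh * ψm + w ^ (19 : ℕ) * Real.log w ^ 2)) ≤
      (C₁ * B ^ (2 * M) * (4 * 10000) * Real.exp (640 * Â ^ 2) * Real.exp cE) * T +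
      (2 * C₁ * B ^ (2 * M) * A ^ 2) * T := by
    -- main part
    have hm1 : (∏ p ∈ (Nat.primesBelow ⌈w⌉₊).erase 2, (1 - 2 / (p : ℝ))) * ψh * ψm * N *
        (Real.exp (640 * Â ^ 2) * Δ) *
        (Real.exp (∑ p ∈ Shiu.primesBelowNotDvd ((⌊w * w⌋₊ : ℝ) + 1) 1, f p * ψ p / p + Shiu.K₅ A (2 * B)) *
         Real.exp (∑ p ∈ Shiu.primesBelowNotDvd ((⌊w * w⌋₊ : ℝ) + 1) 1, g p * ψ p / p + Shiu.K₅ A (2 * B))) ≤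
        (40000 / Real.log X ^ 2) * ψh * ψm * X * (Real.exp (640 * Â ^ 2) * Δ) * (Real.exp cE * G) := by
      have := hψh1; have := hψm1; have := hΔ1
      refine mul_le_mul (mul_le_mul_of_nonneg_right ?_ (by positivity)) hEfg (by positivity) (by positivity)
      exact mul_le_mul (mul_le_mul_of_nonneg_right (mul_le_mul_of_nonneg_right hV (by linarith)) (by linarith))
        hNX (Nat.cast_nonneg N) (by positivity)
    have hm2 : (40000 / Real.log X ^ 2) * ψh * ψm * X * (Real.exp (640 * Â ^ 2) * Δ) * (Real.exp cE * G) =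
        ((4 * 10000) * Real.exp (640 * Â ^ 2) * Real.exp cE) * T := by rw [hT]; ring
    -- junk part
    have hj1 : (w * w) ^ (1 / 3 : ℝ) * (w * w) ^ 2 = X ^ (7 / 150 : ℝ) := by
      rw [hzpow, ← Real.rpow_natCast (X ^ (1 / 50 : ℝ)), ← Real.rpow_mul hX0.le, ← Real.rpow_mul hX0.le, hXpow_mul]
      norm_num
    have hj2 : w ^ (19 : ℕ) * Real.log w ^ 2 ≤ X ^ (19 / 100 : ℝ) * X ^ (1 / 2 : ℝ) := by
      refine mul_le_mul ?_ ?_ (by positivity) (by positivity)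
      · rw [hw, ← Real.rpow_natCast, ← Real.rpow_mul hX0.le]; norm_num
      · refine le_trans ?_ hlogsq
        rw [hlogw]
        have : (Real.log X / 100) ^ 2 = Real.log X ^ 2 / 10000 := by ring
        rw [this]
        exact div_le_self (by positivity) (by norm_num)
    have hj3 : A ^ 2 * (w * w) ^ (1 / 3 : ℝ) * (w * w) ^ 2 * (ψh * ψm + w ^ (19 : ℕ) * Real.log w ^ 2) ≤
        2 * A ^ 2 * T := by
      have e1 : ψh * ψm * X ^ (7 / 150 : ℝ) ≤ T := hTψ' (by norm_num)
      have e2 : X ^ (7 / 150 : ℝ) * (w ^ (19 : ℕ) * Real.log w ^ 2) ≤ T :=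
        (mul_le_mul_of_nonneg_left hj2 (by positivity)).trans (by rw [← mul_assoc]; exact hJ3 (by norm_num))
      calc A ^ 2 * (w * w) ^ (1 / 3 : ℝ) * (w * w) ^ 2 * (ψh * ψm + w ^ (19 : ℕ) * Real.log w ^ 2)
          = A ^ 2 * ((w * w) ^ (1 / 3 : ℝ) * (w * w) ^ 2) * (ψh * ψm + w ^ (19 : ℕ) * Real.log w ^ 2) := by ring
        _ = A ^ 2 * (ψh * ψm * X ^ (7 / 150 : ℝ)) + A ^ 2 * (X ^ (7 / 150 : ℝ) * (w ^ (19 : ℕ) * Real.log w ^ 2)) := by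
            rw [hj1]; ring
        _ ≤ A ^ 2 * T + A ^ 2 * T := by gcongr
        _ = 2 * A ^ 2 * T := by ring
    have hC₁BM : 0 ≤ C₁ * B ^ (2 * M) := by positivity
    calc _ ≤ C₁ * B ^ (2 * M) * (((4 * 10000) * Real.exp (640 * Â ^ 2) * Real.exp cE) * T + 2 * A ^ 2 * T) :=
          mul_le_mul_of_nonneg_left (add_le_add (hm1.trans (le_of_eq hm2)) hj3) hC₁BM
      _ = _ := by ring
  -- (IV)
  have hbIV : C₄ * B ^ (2 * M₁) *
      ((N : ℝ) * ψh * ψm / Real.log (w * w) ^ 2 +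
        (w * w) * (ψh * ψm + ((w * w) ^ (1 / 3 : ℝ)) ^ (19 : ℕ) * Real.log (w * w) ^ 2)) *
      ((Real.exp (640 * Â ^ 2) * Δ) *
        (Real.exp (∑ p ∈ Shiu.primesBelowNotDvd ((⌊w * w⌋₊ : ℝ) + 1) 1, f p * ψ p / p +
            2 * B * Real.exp (8 * M₁ * Real.log B + 8 * Real.log 2) * ((8 * M₁ * Real.log B + 8 * Real.log 2) + 1) +
            Shiu.K₅ A (2 * B)) *
         Real.exp (∑ p ∈ Shiu.primesBelowNotDvd ((⌊w * w⌋₊ : ℝ) + 1) 1, g p * ψ p / p +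
            2 * B * Real.exp (8 * M₁ * Real.log B + 8 * Real.log 2) * ((8 * M₁ * Real.log B + 8 * Real.log 2) + 1) +
            Shiu.K₅ A (2 * B)))) ≤
      (C₄ * B ^ (2 * M₁) * 2500 * Real.exp (640 * Â ^ 2) * Real.exp cΛ) * T +
      (2 * C₄ * B ^ (2 * M₁) * Real.exp (640 * Â ^ 2) * Real.exp cΛ) * T := by
    have hx0 : 0 ≤ X ^ (9995 / 10000 : ℝ) := by positivity
    -- the bracket
    have hbr : (N : ℝ) * ψh * ψm / Real.log (w * w) ^ 2 +
        (w * w) * (ψh * ψm + ((w * w) ^ (1 / 3 : ℝ)) ^ (19 : ℕ) * Real.log (w * w) ^ 2) ≤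
        2500 * (ψh * ψm * (X / Real.log X ^ 2)) + 2 * (ψh * ψm * X ^ (9995 / 10000 : ℝ)) := by
      have h1 : (N : ℝ) * ψh * ψm / Real.log (w * w) ^ 2 ≤ 2500 * (ψh * ψm * (X / Real.log X ^ 2)) := by
        rw [hlogz]
        have : (N : ℝ) * ψh * ψm / (Real.log X / 50) ^ 2 = 2500 * (ψh * ψm * (N / Real.log X ^ 2)) := by
          field_simp; ring
        rw [this]
        gcongr
      have h2 : (w * w) * (ψh * ψm) ≤ ψh * ψm * X ^ (9995 / 10000 : ℝ) := by
        rw [hzpow, mul_comm]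
        exact mul_le_mul_of_nonneg_left (hpowX (by norm_num)) (by positivity)
      have h3 : (w * w) * (((w * w) ^ (1 / 3 : ℝ)) ^ (19 : ℕ) * Real.log (w * w) ^ 2) ≤ ψh * ψm * X ^ (9995 / 10000 : ℝ) := by
        have e1 : ((w * w) ^ (1 / 3 : ℝ)) ^ (19 : ℕ) = X ^ (19 / 150 : ℝ) := by
          rw [hzpow, ← Real.rpow_mul hX0.le, ← Real.rpow_natCast, ← Real.rpow_mul hX0.le]; norm_num
        have e2 : Real.log (w * w) ^ 2 ≤ X ^ (1 / 2 : ℝ) := by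
          refine le_trans ?_ hlogsq
          rw [hlogz]
          have : (Real.log X / 50) ^ 2 = Real.log X ^ 2 / 2500 := by ring
          rw [this]; exact div_le_self (by positivity) (by norm_num)
        calc (w * w) * (((w * w) ^ (1 / 3 : ℝ)) ^ (19 : ℕ) * Real.log (w * w) ^ 2)
            ≤ (w * w) * (X ^ (19 / 150 : ℝ) * X ^ (1 / 2 : ℝ)) := by rw [e1]; gcongr
          _ = X ^ (1 / 50 : ℝ) * X ^ (19 / 150 : ℝ) * X ^ (1 / 2 : ℝ) := by rw [hzpow]; ring
          _ = X ^ (1 / 50 + 19 / 150 + 1 / 2 : ℝ) := by rw [hXpow_mul, hXpow_mul]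
          _ ≤ X ^ (9995 / 10000 : ℝ) := hpowX (by norm_num)
          _ = 1 * X ^ (9995 / 10000 : ℝ) := (one_mul _).symm
          _ ≤ ψh * ψm * X ^ (9995 / 10000 : ℝ) := mul_le_mul_of_nonneg_right hψψ hx0
      calc _ = (N : ℝ) * ψh * ψm / Real.log (w * w) ^ 2 + ((w * w) * (ψh * ψm) +
            (w * w) * (((w * w) ^ (1 / 3 : ℝ)) ^ (19 : ℕ) * Real.log (w * w) ^ 2)) := by ring
        _ ≤ _ := add_le_add h1 (by linarith)
    -- the exponential factor
    have hE : (Real.exp (640 * Â ^ 2) * Δ) *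
        (Real.exp (∑ p ∈ Shiu.primesBelowNotDvd ((⌊w * w⌋₊ : ℝ) + 1) 1, f p * ψ p / p +
            2 * B * Real.exp (8 * M₁ * Real.log B + 8 * Real.log 2) * ((8 * M₁ * Real.log B + 8 * Real.log 2) + 1) +
            Shiu.K₅ A (2 * B)) *
         Real.exp (∑ p ∈ Shiu.primesBelowNotDvd ((⌊w * w⌋₊ : ℝ) + 1) 1, g p * ψ p / p +
            2 * B * Real.exp (8 * M₁ * Real.log B + 8 * Real.log 2) * ((8 * M₁ * Real.log B + 8 * Real.log 2) + 1) +
            Shiu.K₅ A (2 * B))) ≤ (Real.exp (640 * Â ^ 2) * Δ) * (Real.exp cΛ * G) :=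
      mul_le_mul_of_nonneg_left hΛfg (by positivity)
    have hC₄BM : 0 ≤ C₄ * B ^ (2 * M₁) := by positivity
    calc _ ≤ C₄ * B ^ (2 * M₁) * (2500 * (ψh * ψm * (X / Real.log X ^ 2)) + 2 * (ψh * ψm * X ^ (9995 / 10000 : ℝ))) *
          ((Real.exp (640 * Â ^ 2) * Δ) * (Real.exp cΛ * G)) := by
          refine mul_le_mul (mul_le_mul_of_nonneg_left hbr hC₄BM) hE (by positivity) (by positivity)
      _ = (C₄ * B ^ (2 * M₁) * 2500 * Real.exp (640 * Â ^ 2) * Real.exp cΛ) * T +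
          (2 * C₄ * B ^ (2 * M₁) * Real.exp (640 * Â ^ 2) * Real.exp cΛ) *
            (ψh * ψm * X ^ (9995 / 10000 : ℝ) * Δ * G) := by rw [hT]; ring
      _ ≤ (C₄ * B ^ (2 * M₁) * 2500 * Real.exp (640 * Â ^ 2) * Real.exp cΛ) * T +
          (2 * C₄ * B ^ (2 * M₁) * Real.exp (640 * Â ^ 2) * Real.exp cΛ) * T := by
          refine add_le_add le_rfl (mul_le_mul_of_nonneg_left ?_ (by positivity))
          rw [hT]
          calc ψh * ψm * X ^ (9995 / 10000 : ℝ) * Δ * G = ψh * ψm * Δ * X ^ (9995 / 10000 : ℝ) * G := by ring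
            _ ≤ ψh * ψm * Δ * (X / Real.log X ^ 2) * G := by gcongr
  -- Step 7: conclusion
  have hcover := sum_le_sum_classes (F := fun n => f n * g (m * n + h)) (fun n => mul_nonneg (hf0 n) (hg0 _))
    N m h w L₀ Y
  have hfinal : ∑ n ∈ Icc 1 N, f n * g (m * n + h) ≤ (Cmain + Kj) * T := by
    have e := hcover.trans (add_le_add (add_le_add (add_le_add (add_le_add (add_le_add
      (hsmall.trans hb0) (hHcl.trans hbH)) (hIcl.trans hbI)) (hIIcl.trans hbII)) (hIIIcl.trans hbIII))
      (hIVcl.trans hbIV))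
    refine e.trans (le_of_eq ?_)
    rw [hCmain, hKj]; ring
  refine hfinal.trans (le_of_eq ?_)
  rw [hT, hG, hSf, hSg]
  ring

end PairShiu

end Literature.NumberTheory.Sieve
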